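import Summits.NavierStokesRegularity.NavierStokesRegularity.Theses.SymmetryModuliCount
import Summits.NavierStokesRegularity.NavierStokesRegularity.Theses.RecurrentProfiles
import Summits.NavierStokesRegularity.NavierStokesRegularity.Theses.DulacContraction
import Summits.NavierStokesRegularity.NavierStokesRegularity.Theorems.SymmetryModuliCountForcedSymmetryCollapse
import Summits.NavierStokesRegularity.NavierStokesRegularity.Theorems.RecurrentProfilesRecurrentReduction
import Literature.Analysis.FluidPDE.TypeIAncientMild
import Literature.Analysis.FluidPDE.LocalTypeI
import Literature.Analysis.FluidPDE.SelfSimilar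
import HarnessLib

/-!
# Crux `ForcedSymmetry` (stmt-NavierStokesRegularity-4052), line `recurrent-closing`: the split glue

Route `SymmetryModuliCount`, sub-problem `NavierStokesRegularity`.  Lead seat c3 (2026-08-17), landing the
crux-strategist's sorry-free composition (census `Cruxes/ForcedSymmetry/STRATEGY-CENSUS.md` v2 §D5/R6; the
strategist cannot propose under `Theorems`).

The registered skeleton `Cruxes/ForcedSymmetry/Lines/recurrent_closing.lean` factors the route target
`X = TypeIAncientLiouville` — and hence the crux `ForcedSymmetry`, by the landed collapse
`forcedSymmetry_of_typeIAncientLiouville` — as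

  `X ⇐ SlabProfileOfNonzero (bridge) ∘ RecurrentReduction (stmt-1590, PROVED: recurrentReduction_proof)
       ∘ RecurrentClosing (new) ∘ RDSSLiouvilleInClass (stmt-8561, by name)`.

This file is that composition with the three stub STATEMENTS as hypotheses (pure logic, no analysis), so that
a route split `--glue-by forcedSymmetry_of_recurrentClosing_subs` is kernel-checked:

* `typeIAncientLiouville_of_recurrentClosing_subs` — the three statements give `X`;
* `forcedSymmetry_of_recurrentClosing_subs` — hence the crux.

References: D. Albritton, T. Barker, J. Math. Fluid Mech. 21 (2019) [AlbrittonBarker2019]; census §D5.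
-/

noncomputable section

-- the summit and its single problem share the name (D-0017 nested layout)
set_option linter.dupNamespace false

open MeasureTheory Set Filter Topology

namespace Summit.NavierStokesRegularity.NavierStokesRegularity.Theorems.SymmetryModuliCountForcedSymmetry.RecurrentClosingSplit

/-- **The route target from the three pieces of the line `recurrent-closing`.**  Hypotheses, verbatim the
registered stubs of the skeleton: `h₁` = `stub_slabProfileOfNonzero` (a nonzero `u ∈ A_C` yields a slab profile of
Albritton–Barker's local Type-I class singular at the origin), `h₂` = `stub_recurrentClosing` (a uniformly
scaling-recurrent singular Type-I profile is accompanied by a rotated-discretely-self-similar singular smooth one),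
`h₃` = `DulacContraction.RDSSLiouvilleInClass` (stmt-8561: such a profile is regular at the origin).  Composition
through the LANDED `recurrentReduction_proof` (stmt-1590).  [cite: AlbrittonBarker2019, Thm 1.1 (the class); census §D5] -/
theorem typeIAncientLiouville_of_recurrentClosing_subs
    (h₁ : ∀ (C : ℝ) (u : ℝ → EuclideanSpace ℝ (Fin 3) → EuclideanSpace ℝ (Fin 3)),
      Literature.Analysis.FluidPDE.IsTypeIAncientMild C u →
      (∃ t : ℝ, t < 0 ∧ ∃ x : EuclideanSpace ℝ (Fin 3), u t x ≠ 0) →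
      ∃ (w : ℝ → EuclideanSpace ℝ (Fin 3) → EuclideanSpace ℝ (Fin 3)) (q : ℝ → EuclideanSpace ℝ (Fin 3) → ℝ)
        (G : ℝ → EuclideanSpace ℝ (Fin 3) → EuclideanSpace ℝ (Fin 3) →L[ℝ] EuclideanSpace ℝ (Fin 3)) (C' : ℝ),
        Literature.Analysis.FluidPDE.IsSuitableWeakSolutionOn
            (Literature.Analysis.FluidPDE.slab (EuclideanSpace ℝ (Fin 3)) (Set.Iio 0) isOpen_Iio) 1 0 w q ∧
        Literature.Analysis.FluidPDE.HasWeakSpatialGradientOn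
            (Literature.Analysis.FluidPDE.slab (EuclideanSpace ℝ (Fin 3)) (Set.Iio 0) isOpen_Iio) w G ∧
        Literature.Analysis.FluidPDE.typeIBound (Set.Iio (0 : ℝ) ×ˢ Set.univ) w q G < ⊤ ∧
        Literature.Analysis.FluidPDE.HasTypeITimeDecay C' w ∧
        Literature.Analysis.FluidPDE.IsBackwardSingularPoint w 0)
    (h₂ : ∀ (u : ℝ → EuclideanSpace ℝ (Fin 3) → EuclideanSpace ℝ (Fin 3)) (p : ℝ → EuclideanSpace ℝ (Fin 3) → ℝ)
      (G : ℝ → EuclideanSpace ℝ (Fin 3) → EuclideanSpace ℝ (Fin 3) →L[ℝ] EuclideanSpace ℝ (Fin 3)) (C : ℝ),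
      Literature.Analysis.FluidPDE.IsSuitableWeakSolutionOn
          (Literature.Analysis.FluidPDE.slab (EuclideanSpace ℝ (Fin 3)) (Set.Iio 0) isOpen_Iio) 1 0 u p →
      Literature.Analysis.FluidPDE.HasWeakSpatialGradientOn
          (Literature.Analysis.FluidPDE.slab (EuclideanSpace ℝ (Fin 3)) (Set.Iio 0) isOpen_Iio) u G →
      Literature.Analysis.FluidPDE.typeIBound (Set.Iio (0 : ℝ) ×ˢ Set.univ) u p G < ⊤ →
      Literature.Analysis.FluidPDE.HasTypeITimeDecay C u →
      (∀ ε : ℝ, 0 < ε → ∀ K : Set (ℝ × EuclideanSpace ℝ (Fin 3)), IsCompact K → K ⊆ Set.Iic (0 : ℝ) ×ˢ Set.univ →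
        ∃ L : ℝ, 0 < L ∧ ∀ a : ℝ, ∃ σ ∈ Set.Icc a (a + L),
          MeasureTheory.eLpNorm (fun z : ℝ × EuclideanSpace ℝ (Fin 3) =>
            Literature.Analysis.FluidPDE.nsRescale (Real.exp σ) u z.1 z.2 - u z.1 z.2) 3
            (MeasureTheory.volume.restrict K) ≤ ENNReal.ofReal ε) →
      Literature.Analysis.FluidPDE.IsBackwardSingularPoint u 0 →
      ∃ (w : ℝ → EuclideanSpace ℝ (Fin 3) → EuclideanSpace ℝ (Fin 3)) (q : ℝ → EuclideanSpace ℝ (Fin 3) → ℝ)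
        (H : ℝ → EuclideanSpace ℝ (Fin 3) → EuclideanSpace ℝ (Fin 3) →L[ℝ] EuclideanSpace ℝ (Fin 3)) (C' : ℝ),
        Literature.Analysis.FluidPDE.IsSuitableWeakSolutionOn
            (Literature.Analysis.FluidPDE.slab (EuclideanSpace ℝ (Fin 3)) (Set.Iio 0) isOpen_Iio) 1 0 w q ∧
        Literature.Analysis.FluidPDE.HasWeakSpatialGradientOn
            (Literature.Analysis.FluidPDE.slab (EuclideanSpace ℝ (Fin 3)) (Set.Iio 0) isOpen_Iio) w H ∧
        Literature.Analysis.FluidPDE.typeIBound (Set.Iio (0 : ℝ) ×ˢ Set.univ) w q H < ⊤ ∧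
        Literature.Analysis.FluidPDE.HasTypeITimeDecay C' w ∧
        Literature.Analysis.FluidPDE.IsClassicalNSSolutionOn (Set.Iio 0) 1 0 w q ∧
        (∃ l : ℝ, 1 < l ∧ ∃ (R : EuclideanSpace ℝ (Fin 3) ≃ₗᵢ[ℝ] EuclideanSpace ℝ (Fin 3))
            (ξ : EuclideanSpace ℝ (Fin 3)) (τ : ℝ), τ ≤ 0 ∧
            (fun z : ℝ × EuclideanSpace ℝ (Fin 3) => l • R.symm (w (l ^ 2 * z.1 + τ) (l • R z.2 + ξ)))
              =ᵐ[MeasureTheory.volume.restrict (Set.Iio (0 : ℝ) ×ˢ Set.univ)]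
            (fun z : ℝ × EuclideanSpace ℝ (Fin 3) => w z.1 z.2)) ∧
        Literature.Analysis.FluidPDE.IsBackwardSingularPoint w 0)
    (h₃ : Summit.NavierStokesRegularity.NavierStokesRegularity.Theses.DulacContraction.RDSSLiouvilleInClass) :
    Summit.NavierStokesRegularity.NavierStokesRegularity.Theses.SymmetryModuliCount.TypeIAncientLiouville := by
  intro C u hu t ht x
  by_contra hx
  have hu' : Literature.Analysis.FluidPDE.IsTypeIAncientMild C u :=
    Literature.Analysis.FluidPDE.isTypeIAncientMild_iff.2 hu
  obtain ⟨w, q, G, C', hw, hG, hI, hC', hsing⟩ := h₁ C u hu' ⟨t, ht, x, hx⟩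
  obtain ⟨w₁, q₁, H₁, hw₁, hG₁, hI₁, hC₁, hsing₁, hrec₁⟩ :=
    Summit.NavierStokesRegularity.NavierStokesRegularity.Theorems.recurrentReduction_proof w q G C' hw hG hI hC' hsing
  obtain ⟨w₂, q₂, H₂, C₂, hw₂, hG₂, hI₂, hC₂, hcl₂, hrdss₂, hsing₂⟩ :=
    h₂ w₁ q₁ H₁ C' hw₁ hG₁ hI₁ hC₁ hrec₁ hsing₁
  exact h₃ w₂ q₂ H₂ C₂ hw₂ hG₂ hI₂ hC₂ hcl₂ hrdss₂ hsing₂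

/-- **The crux from the three pieces of the line `recurrent-closing`** (the `--glue-by` theorem of the census's
prepared route split, R6): `SlabProfileOfNonzero → RecurrentClosing → RDSSLiouvilleInClass → ForcedSymmetry`, via
`typeIAncientLiouville_of_recurrentClosing_subs` and the landed collapse direction
`forcedSymmetry_of_typeIAncientLiouville` (the zero field carries every similarity symmetry).
[cite: AlbrittonBarker2019, Thm 1.1 (the class); census §D5/R6] -/
theorem forcedSymmetry_of_recurrentClosing_subs
    (h₁ : ∀ (C : ℝ) (u : ℝ → EuclideanSpace ℝ (Fin 3) → EuclideanSpace ℝ (Fin 3)),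
      Literature.Analysis.FluidPDE.IsTypeIAncientMild C u →
      (∃ t : ℝ, t < 0 ∧ ∃ x : EuclideanSpace ℝ (Fin 3), u t x ≠ 0) →
      ∃ (w : ℝ → EuclideanSpace ℝ (Fin 3) → EuclideanSpace ℝ (Fin 3)) (q : ℝ → EuclideanSpace ℝ (Fin 3) → ℝ)
        (G : ℝ → EuclideanSpace ℝ (Fin 3) → EuclideanSpace ℝ (Fin 3) →L[ℝ] EuclideanSpace ℝ (Fin 3)) (C' : ℝ),
        Literature.Analysis.FluidPDE.IsSuitableWeakSolutionOn
            (Literature.Analysis.FluidPDE.slab (EuclideanSpace ℝ (Fin 3)) (Set.Iio 0) isOpen_Iio) 1 0 w q ∧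
        Literature.Analysis.FluidPDE.HasWeakSpatialGradientOn
            (Literature.Analysis.FluidPDE.slab (EuclideanSpace ℝ (Fin 3)) (Set.Iio 0) isOpen_Iio) w G ∧
        Literature.Analysis.FluidPDE.typeIBound (Set.Iio (0 : ℝ) ×ˢ Set.univ) w q G < ⊤ ∧
        Literature.Analysis.FluidPDE.HasTypeITimeDecay C' w ∧
        Literature.Analysis.FluidPDE.IsBackwardSingularPoint w 0)
    (h₂ : ∀ (u : ℝ → EuclideanSpace ℝ (Fin 3) → EuclideanSpace ℝ (Fin 3)) (p : ℝ → EuclideanSpace ℝ (Fin 3) → ℝ)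
      (G : ℝ → EuclideanSpace ℝ (Fin 3) → EuclideanSpace ℝ (Fin 3) →L[ℝ] EuclideanSpace ℝ (Fin 3)) (C : ℝ),
      Literature.Analysis.FluidPDE.IsSuitableWeakSolutionOn
          (Literature.Analysis.FluidPDE.slab (EuclideanSpace ℝ (Fin 3)) (Set.Iio 0) isOpen_Iio) 1 0 u p →
      Literature.Analysis.FluidPDE.HasWeakSpatialGradientOn
          (Literature.Analysis.FluidPDE.slab (EuclideanSpace ℝ (Fin 3)) (Set.Iio 0) isOpen_Iio) u G →
      Literature.Analysis.FluidPDE.typeIBound (Set.Iio (0 : ℝ) ×ˢ Set.univ) u p G < ⊤ →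
      Literature.Analysis.FluidPDE.HasTypeITimeDecay C u →
      (∀ ε : ℝ, 0 < ε → ∀ K : Set (ℝ × EuclideanSpace ℝ (Fin 3)), IsCompact K → K ⊆ Set.Iic (0 : ℝ) ×ˢ Set.univ →
        ∃ L : ℝ, 0 < L ∧ ∀ a : ℝ, ∃ σ ∈ Set.Icc a (a + L),
          MeasureTheory.eLpNorm (fun z : ℝ × EuclideanSpace ℝ (Fin 3) =>
            Literature.Analysis.FluidPDE.nsRescale (Real.exp σ) u z.1 z.2 - u z.1 z.2) 3
            (MeasureTheory.volume.restrict K) ≤ ENNReal.ofReal ε) →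
      Literature.Analysis.FluidPDE.IsBackwardSingularPoint u 0 →
      ∃ (w : ℝ → EuclideanSpace ℝ (Fin 3) → EuclideanSpace ℝ (Fin 3)) (q : ℝ → EuclideanSpace ℝ (Fin 3) → ℝ)
        (H : ℝ → EuclideanSpace ℝ (Fin 3) → EuclideanSpace ℝ (Fin 3) →L[ℝ] EuclideanSpace ℝ (Fin 3)) (C' : ℝ),
        Literature.Analysis.FluidPDE.IsSuitableWeakSolutionOn
            (Literature.Analysis.FluidPDE.slab (EuclideanSpace ℝ (Fin 3)) (Set.Iio 0) isOpen_Iio) 1 0 w q ∧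
        Literature.Analysis.FluidPDE.HasWeakSpatialGradientOn
            (Literature.Analysis.FluidPDE.slab (EuclideanSpace ℝ (Fin 3)) (Set.Iio 0) isOpen_Iio) w H ∧
        Literature.Analysis.FluidPDE.typeIBound (Set.Iio (0 : ℝ) ×ˢ Set.univ) w q H < ⊤ ∧
        Literature.Analysis.FluidPDE.HasTypeITimeDecay C' w ∧
        Literature.Analysis.FluidPDE.IsClassicalNSSolutionOn (Set.Iio 0) 1 0 w q ∧
        (∃ l : ℝ, 1 < l ∧ ∃ (R : EuclideanSpace ℝ (Fin 3) ≃ₗᵢ[ℝ] EuclideanSpace ℝ (Fin 3))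
            (ξ : EuclideanSpace ℝ (Fin 3)) (τ : ℝ), τ ≤ 0 ∧
            (fun z : ℝ × EuclideanSpace ℝ (Fin 3) => l • R.symm (w (l ^ 2 * z.1 + τ) (l • R z.2 + ξ)))
              =ᵐ[MeasureTheory.volume.restrict (Set.Iio (0 : ℝ) ×ˢ Set.univ)]
            (fun z : ℝ × EuclideanSpace ℝ (Fin 3) => w z.1 z.2)) ∧
        Literature.Analysis.FluidPDE.IsBackwardSingularPoint w 0)
    (h₃ : Summit.NavierStokesRegularity.NavierStokesRegularity.Theses.DulacContraction.RDSSLiouvilleInClass) :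
    Summit.NavierStokesRegularity.NavierStokesRegularity.Theses.SymmetryModuliCount.ForcedSymmetry :=
  Summit.NavierStokesRegularity.NavierStokesRegularity.Theorems.forcedSymmetry_of_typeIAncientLiouville
    (typeIAncientLiouville_of_recurrentClosing_subs h₁ h₂ h₃)

end Summit.NavierStokesRegularity.NavierStokesRegularity.Theorems.SymmetryModuliCountForcedSymmetry.RecurrentClosingSplit

end
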